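import Summits.HodgeConjecture.HodgeConjecture.Theorems.H413E2SWDilateBoundCM
import Summits.HodgeConjecture.HodgeConjecture.Theorems.H413E2SWBorelBoundTorus
import Summits.HodgeConjecture.HodgeConjecture.Theorems.H413E2SWSplitPlaceFrameTorus
import Summits.HodgeConjecture.HodgeConjecture.Theorems.H413E2SWSplitPlaceTorusNormInverse
import Literature.NumberTheory.Automorphic.QuadraticHermitianNormTorusTwistGL
import HarnessLib

/-!
# H413 · E-2 · SW2 (iii) — I-CLOSE step (S-1), THE LEVI LETTER (L-D-v) AT THE CM ∕ UNITARY DATUM: `hLD_CM`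

Cell `hodgecm-mathlib`, crux H413 (`stmt-HodgeConjecture-24833`), child line `Cruxes/H413/Lines/F0_E2SiegelWeilWeilRange.lean`, stub
`stub_SW2iii_siegelWeil`, identity half.  PROOF lane, `--supports stmt-HodgeConjecture-24833 --as helper`.  Seat F0P4-p01 (g3), row booked by
F0P4-plan (g4) 2026-08-31T05:14:34Z («(S-1) GLUE ED. 3 §8», recipe of record F0P4-p05 (g2) `S1-GLUE-SPEC.hbd_CM_of_letters` 34152eb7).
KERNEL MATHEMATICS ONLY (theorems; no definition, no `sorry`).  HC_CM is proved only modulo the 7 printed citations until rung 0 closes;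
nothing in this file is about Hodge classes.

WHAT THIS FILE DOES.  ★ (S-1) `E2SWDilateBoundCM.hbd_CM` (Weil's (39)) and its consumer ★ (T4) `E2SWIdentityCloseFibreCM.hfib_CM_of` carry ONE
frame letter that is not a structure fact of the metaplectic group but a statement about the split place `v`: **(L-D-v) `hLD`** — for every
`s ∈ F_v^×` there is `q ∈ Mp(X□_𝔸)` over a "Borel" element `u = d(t) ∈ U_D(𝔸_F)` (`u₀₀ + u₀₁ = u₁₀ + u₁₁`, `proj q = j u`) with modulus
`L(q) = |s|_v^n` acting on `𝒮(X□(𝔸_F))`, read through the split-place frame `fr = (β_v × id) ∘ placeSplitting⁻¹`, as the dilation of the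
`x`-half ALONE: `(ω(q)Ψ)(x) = Ψ(fr⁻¹((s⁻¹ • (fr x).1.1, (fr x).1.2), (fr x).2))`.  We DISCHARGE it at the CM datum in A4's frame of record
(`𝕋 = doubledGramFin (adelicGram)`, the hom `j = conj(π u₀ · π(doublingDeltaLift)) ∘ spReindex ∘ jS`, the Cayley matrix `M`), by pure composition:

* (ζ) a ONE-PLACE TORUS IDELE `t ∈ 𝔸_E^×` with `c̄t = p₂ + q₂δ`, `(p₂, q₂)_v = (a, b)`, `a + s√d b = s⁻¹`, `a − s√d b = 1`, `(p₂, q₂) = (1, 0)` off `v`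
  [A-p01 (g13), `E2SWSplitPlaceFrame.exists_onePlaceTorusIdele`];
* (ε) the torus twist `Mt = M(p₂,q₂) ∈ GL_{n+n}(𝔸_F)` [★ B-p04 (g24) `UnitaryGroup.exists_torusTwistGL`];
* (α) the metaplectic lift `q` over the Levi element `d(t) = M·diag(t,(c̄t)⁻¹)·M⁻¹` with `ω(q) = twistLM Mt` [★ A-p16 (g18)
  `E2SWBorelBoundTorus.exists_lift_torus`];
* (β) the row-sum ("Borel") condition of `M·D·M⁻¹` [★ F0P4-p05 (g2) `rowSum_conj_of_diag`];
* (γ) `L(q) = |det Mt⁻¹|_𝔸` [★ F0P4-p05 (g2) `l2Scaling_eq_of_omega_eq_twistLM`] and (η)(θ) `|det Mt⁻¹|_𝔸 = |s|_v^n` (a one-place matrix)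
  [★ B-p02 (g19) `AdelicAbsDetOnePlace`, ★ A-p07 (g19) `E2SWSplitPlaceTorusNormInverse.adelicAbsDet_torusTwist_inv_eq_normAbs_pow_inv`];
* (δ) the frame reads `x ↦ x·Mt` as `((a + s√d b) • z₁, (a − s√d b) • z₂) = (s⁻¹ • z₁, z₂)` [★ A-p01 (g13) `E2SWSplitPlaceFrame.twistLM_torus_apply`].

The frame `(βv, fr, he1, he2)` is the one of (T1) ∕ ★ B-p02 `frame_identityClose_triples_all_of_frame`, ON A-p01's coordinates `β` (`hβ` the formula
`β_v y = (y¹ + s√d 𝕋_v⁻¹ y², 𝕋_v y¹ − s√d y²)`, `hβv : βv = β` pointwise) — the torus is the `(s⁻¹, 1)`-dilation of the halves only in these coordinates.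

References: A. Weil, *Sur la formule de Siegel dans la théorie des groupes classiques*, Acta Math. 113 (1965), Chap. V n° 47 Lemme 20 p. 67,
n° 50 (39) pp. 73–74 [Weil1965]; A. Weil, *Sur certains groupes d'opérateurs unitaires*, Acta Math. 111 (1964), Chap. I n° 13 p. 160 [Weil1964];
J.-S. Li, *Non-vanishing theorems for the cohomology of certain arithmetic quotients*, J. reine angew. Math. 428 (1992), p. 181 [Li1992].
-/

set_option autoImplicit false
-- the cell's `Summit.HodgeConjecture.HodgeConjecture.…` namespace repeats the summit name by design (D-0017 layout)
set_option linter.dupNamespace false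

noncomputable section

open MeasureTheory NumberField Filter Topology Set IsDedekindDomain
open scoped NNReal ENNReal Matrix
open Literature.NumberTheory.Automorphic Literature.NumberTheory.Automorphic.AdelicVector
open Literature.NumberTheory.Weil1964 Literature.NumberTheory.Weil1965 Literature.NumberTheory.Weil1965.UnitaryDoubling
open Literature.NumberTheory.GaloisRepresentations.IsNonarchimedeanLocalField
open Literature.RepresentationTheory.HeisenbergGroup
open Literature.NumberTheory.Automorphic.DoubledUnitary.RankOneReduction
open Literature.NumberTheory.Automorphic.UnitaryGroup
open Literature.NumberTheory.Automorphic.UnitaryGroup.QuadraticCoordinates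
open Literature.NumberTheory.GelbartRogawski1991 Literature.NumberTheory.GelbartRogawski1991.UnitaryDualPair
open Summit.HodgeConjecture.HodgeConjecture.Cruxes.H413
open Summit.HodgeConjecture.HodgeConjecture.Cruxes.H413.E2SWBorelBoundFrame

namespace Summit.HodgeConjecture.HodgeConjecture.Cruxes.H413.E2SWDilateBoundCM

/-! ## §8 The Levi letter (L-D-v) `hLD` at the CM ∕ unitary datum, in A4's frame of record -/

section Letters

variable (F E : Type) [Field F] [NumberField F] [Field E] [NumberField E] [Algebra F E] [Algebra.IsQuadraticExtension F E]
  (c : E ≃ₐ[F] E) {δ : E} (hcδ : c δ = -δ) (hδ : δ ≠ 0) {d : F} (hd : δ * δ = algebraMap F E d)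
  (N : ℕ) {n : ℕ} (e : Fin N × Fin 1 ≃ Fin n)
  (TV : Matrix (Fin N) (Fin N) F) (hV : TV.IsSymm) (hVd : IsUnit TV.det)
  (TW : Matrix (Fin 1) (Fin 1) F) (hW : TW.IsSymm) (hWd : IsUnit TW.det)
  (hW2 : (Matrix.reindex finSumFinEquiv finSumFinEquiv (Matrix.fromBlocks TW 0 0 (-TW))).IsSymm)
  [MeasurableSpace (AdeleRing (𝓞 F) F)] [BorelSpace (AdeleRing (𝓞 F) F)]
  (νX : Measure (Fin (n + n) → AdeleRing (𝓞 F) F)) [νX.IsAddHaarMeasure]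
  (v : HeightOneSpectrum (𝓞 F))

include hδ hV hW in
/-- **(L-D-v) `hLD_CM` — THE LEVI DILATIONS AT THE SPLIT PLACE `v`, AS METAPLECTIC ELEMENTS OVER `U_D`, IN A4's FRAME.**
For every `s ∈ F_v^×` there are `q ∈ Mp(X□(𝔸_F))` (metaplectic currency `adelicMpCont F (Fin (n+n)) (doubledGramFin (adelicGram))`) and
`u = d(t) = M·diag(t,(c̄t)⁻¹)·M⁻¹ ∈ U_D(𝔸_F)` with: the row-sum ("Borel") condition on `u`; `proj q = j u`; `L(q) = |s|_v^n`; and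
`(ω(q)Ψ)(x) = Ψ(fr⁻¹((s⁻¹ • (fr x).1.1, (fr x).1.2), (fr x).2))` — EXACTLY the `hLD` binder of ★ `hbd_CM` ∕ ★ (T4) `hfib_CM_of` at
`K := F_v`, `κ := Fin n`, `𝕋 := doubledGramFin F (adelicGram F e TV TW)`, `j` := A4's hom of record, at a frame `(βv, fr, he1, he2)` whose
`βv` IS A-p01's `β` (`hβ` its formula, `hβv : βv = β` pointwise — the first conjunct of ★ B-p02 `frame_identityClose_triples_all_of_frame`).
Binders `h2 hTW hTs u₀ hu₀ jS hjS j hj M hM` are those of ★ A4 `exists_borelBound_frame` ∕ ★ (α) `exists_lift_torus` VERBATIM; `hIDL` = (ζ)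
the one-place torus ideles (A-p01 `exists_onePlaceTorusIdele`, announced shape) — a NAMED BINDER until ★, discharged by name in the next edition.
Proof: (ζ) at `r := s⁻¹` → (ε) ★ `exists_torusTwistGL` → (α) ★ `exists_lift_torus` → ⟨(β) ★ `rowSum_conj_of_diag`, `proj`, (γ) ★
`l2Scaling_eq_of_omega_eq_twistLM` + (η)(θ) ★ `adelicAbsDet_torusTwist_inv_eq_normAbs_pow_inv`, (δ) ★ `twistLM_torus_apply`⟩.
[cite: Weil1965, Chap. V n° 50, (39) pp. 73–74] [cite: Weil1965, n° 47 Lemme 20 (p. 67)] [cite: Weil1964, Chap. I n° 13 p. 160] [cite: Li1992, p. 181] -/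
theorem hLD_CM [IsGalois F E] (h2 : ∀ σ : E ≃ₐ[F] E, σ = 1 ∨ σ = c) (hTW : TW 0 0 ≠ 0)
    (hTs : (adelicGram F e TV TW).IsSymm)
    (u₀ : adelicMpCont F (Fin (n + n)) (doubledGramFin F (adelicGram F e TV TW)))
    (hu₀ : ∀ Ψ : piSchwartzBruhat F (Fin (n + n)),
      ((adelicMpCont.omega F (Fin (n + n)) (doubledGramFin F (adelicGram F e TV TW)) u₀ Ψ : piSchwartzBruhat F (Fin (n + n))) :
          (Fin (n + n) → AdeleRing (𝓞 F) F) → ℂ) =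
        chirp F (ratMatrix F (frameHalfRat F)) (Ψ : (Fin (n + n) → AdeleRing (𝓞 F) F) → ℂ))
    -- the `W`-side hom into the sum model (★ `exists_sumModelHom`, first conjunct)
    (jS : ↥(UnitaryGroup.adelic F E c (1 + 1)
        ((Matrix.reindex finSumFinEquiv finSumFinEquiv (Matrix.fromBlocks TW 0 0 (-TW))).map (algebraMap F E))) →*
      ↥(symplecticGroup (polar (Matrix.toLinearMap₂' (AdeleRing (𝓞 F) F)
        (Matrix.fromBlocks (adelicGram F e TV TW) 0 0 (-adelicGram F e TV TW))))))
    (hjS : ∀ (A : ↥(UnitaryGroup.adelic F E c (1 + 1)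
        ((Matrix.reindex finSumFinEquiv finSumFinEquiv (Matrix.fromBlocks TW 0 0 (-TW))).map (algebraMap F E))))
        (v : (Fin (n + n) → AdeleRing (𝓞 F) F) × (Fin (n + n) → AdeleRing (𝓞 F) F)),
      ((spReindex (finSumFinEquiv : Fin n ⊕ Fin n ≃ Fin (n + n))
          (Matrix.fromBlocks (adelicGram F e TV TW) 0 0 (-adelicGram F e TV TW)) (jS A) :
          symplecticGroup (polar (Matrix.toLinearMap₂' (AdeleRing (𝓞 F) F)
            (Matrix.reindex finSumFinEquiv finSumFinEquiv
              (Matrix.fromBlocks (adelicGram F e TV TW) 0 0 (-adelicGram F e TV TW)))))) :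
        ((Fin (n + n) → AdeleRing (𝓞 F) F) × (Fin (n + n) → AdeleRing (𝓞 F) F)) ≃ₗ[AdeleRing (𝓞 F) F]
          ((Fin (n + n) → AdeleRing (𝓞 F) F) × (Fin (n + n) → AdeleRing (𝓞 F) F))) v =
      ((toSp F E c N (1 + 1)
          (((Equiv.prodCongr (Equiv.refl (Fin N)) finSumFinEquiv.symm).trans (Equiv.prodSumDistrib (Fin N) (Fin 1) (Fin 1))).trans
            ((Equiv.sumCongr e e).trans finSumFinEquiv))
          (TV.map (algebraMap F E)) ((Matrix.reindex finSumFinEquiv finSumFinEquiv (Matrix.fromBlocks TW 0 0 (-TW))).map (algebraMap F E))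
          hcδ hδ hd hV hW2 rfl rfl
          (adelicInr F E c N (1 + 1) (TV.map (algebraMap F E))
            ((Matrix.reindex finSumFinEquiv finSumFinEquiv (Matrix.fromBlocks TW 0 0 (-TW))).map (algebraMap F E)) A) :
          symplecticGroup (polar (adelicForm F (Fin (n + n))
            (adelicGram F
              (((Equiv.prodCongr (Equiv.refl (Fin N)) finSumFinEquiv.symm).trans (Equiv.prodSumDistrib (Fin N) (Fin 1) (Fin 1))).trans
                ((Equiv.sumCongr e e).trans finSumFinEquiv)) TV
              (Matrix.reindex finSumFinEquiv finSumFinEquiv (Matrix.fromBlocks TW 0 0 (-TW))))))) :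
        ((Fin (n + n) → AdeleRing (𝓞 F) F) × (Fin (n + n) → AdeleRing (𝓞 F) F)) ≃ₗ[AdeleRing (𝓞 F) F]
          ((Fin (n + n) → AdeleRing (𝓞 F) F) × (Fin (n + n) → AdeleRing (𝓞 F) F))) v)
    -- THE HOM OF RECORD `j = conj(π u₀ · π(doublingDeltaLift)) ∘ spReindex ∘ jS`
    (j : ↥(UnitaryGroup.adelic F E c (1 + 1)
        ((Matrix.reindex finSumFinEquiv finSumFinEquiv (Matrix.fromBlocks TW 0 0 (-TW))).map (algebraMap F E))) →*
      ↥(symplecticGroup (polar (adelicForm F (Fin (n + n)) (doubledGramFin F (adelicGram F e TV TW))))))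
    (hj : j = (MulAut.conj (adelicMpCont.proj F (Fin (n + n)) (doubledGramFin F (adelicGram F e TV TW)) u₀ *
        adelicMpCont.proj F (Fin (n + n)) (doubledGramFin F (adelicGram F e TV TW))
          (doublingDeltaLift F (adelicGram F e TV TW) (isUnit_det_adelicGram F e hVd hWd)))).toMonoidHom.comp
      ((spReindex (finSumFinEquiv : Fin n ⊕ Fin n ≃ Fin (n + n))
        (Matrix.fromBlocks (adelicGram F e TV TW) 0 0 (-adelicGram F e TV TW))).comp jS))
    -- the Cayley matrix
    {M : GL (Fin 2) (AdeleRing (𝓞 E) E)}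
    (hM : (M : Matrix (Fin 2) (Fin 2) (AdeleRing (𝓞 E) E)) =
      !![1, algebraMap E (AdeleRing (𝓞 E) E) (algebraMap F E (2 * TW 0 0)⁻¹);
        1, -algebraMap E (AdeleRing (𝓞 E) E) (algebraMap F E (2 * TW 0 0)⁻¹)])
    -- the split place `v`: `sd ² = d` in `F_v`
    {sd : v.adicCompletion F} (hs : sd * sd = algebraMap F (v.adicCompletion F) d)
    -- A-p01's coordinates `β_v` WITH THEIR FORMULA (★ `exists_splitPlaceFrame₃` ∕ `exists_splitPlaceSelector₃`, first clause)
    (β : (Fin (n + n) → v.adicCompletion F) ≃ₗ[v.adicCompletion F] ((Fin n → v.adicCompletion F) × (Fin n → v.adicCompletion F)))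
    (hβ : ∀ y, β y =
        ((fun i => y (Fin.castAdd n i)) +
            sd • ((UnitaryDualPair.gram F e TV TW).map (algebraMap F (v.adicCompletion F)))⁻¹ *ᵥ (fun i => y (Fin.natAdd n i)),
          (UnitaryDualPair.gram F e TV TW).map (algebraMap F (v.adicCompletion F)) *ᵥ (fun i => y (Fin.castAdd n i)) -
            sd • (fun i => y (Fin.natAdd n i))))
    -- the frame of (T1) ∕ ★ `frame_identityClose_triples_all_of_frame` (B-p02), read on the SAME `β` (`hβv` = its first conjunct)
    (βv : (Fin (n + n) → v.adicCompletion F) ≃ₜ ((Fin n → v.adicCompletion F) × (Fin n → v.adicCompletion F)))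
    (fr : (Fin (n + n) → AdeleRing (𝓞 F) F) ≃ₜ
      (((Fin n → v.adicCompletion F) × (Fin n → v.adicCompletion F)) × trivialAt F (Fin (n + n)) v))
    (he1 : ∀ x, (fr x).1 = βv (evalAt F (Fin (n + n)) v x))
    (he2 : ∀ x, (fr x).2 = ((placeSplitting F (Fin (n + n)) v).symm x).2)
    (hβv : ∀ y, βv y = β y)
    -- (ζ) ONE-PLACE TORUS IDELES [A-p01 (g13) `exists_onePlaceTorusIdele`, announced shape 05:15:45Z] — named binder until ★
    (hIDL : ∀ r : v.adicCompletion F, r ≠ 0 →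
      ∃ (t : (AdeleRing (𝓞 E) E)ˣ) (p₂ q₂ : AdeleRing (𝓞 F) F) (a b : v.adicCompletion F),
        QuadraticCoordinates.re (quadraticAdeleEquiv F E c hcδ hδ).toAddEquiv (UnitaryGroup.conjAdele F E c (t : AdeleRing (𝓞 E) E)) = p₂ ∧
        QuadraticCoordinates.im (quadraticAdeleEquiv F E c hcδ hδ).toAddEquiv (UnitaryGroup.conjAdele F E c (t : AdeleRing (𝓞 E) E)) = q₂ ∧
        AdelicGroupData.adeleEval F v p₂ = a ∧ AdelicGroupData.adeleEval F v q₂ = b ∧ a + sd * b = r ∧ a - sd * b = 1 ∧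
        (∀ z : AdeleRing (𝓞 F) F, AdelicGroupData.adeleEval F v z = 0 → p₂ * z = z) ∧
        (∀ z : AdeleRing (𝓞 F) F, AdelicGroupData.adeleEval F v z = 0 → q₂ * z = 0) ∧
        p₂ * p₂ - algebraMap F (AdeleRing (𝓞 F) F) d * (q₂ * q₂) = 1 - adeleSingleHom F v 1 + adeleSingleHom F v r ∧
        ∃ p₂' q₂' : AdeleRing (𝓞 F) F, p₂ * p₂' + algebraMap F (AdeleRing (𝓞 F) F) d * (q₂ * q₂') = 1 ∧ p₂ * q₂' + q₂ * p₂' = 0) :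
    ∀ s : v.adicCompletion F, s ≠ 0 →
      ∃ (q : adelicMpCont F (Fin (n + n)) (doubledGramFin F (adelicGram F e TV TW))) (u : GL (Fin (1 + 1)) (AdeleRing (𝓞 E) E))
        (hu : u ∈ UnitaryGroup.adelic F E c (1 + 1)
          ((Matrix.reindex finSumFinEquiv finSumFinEquiv (Matrix.fromBlocks TW 0 0 (-TW))).map (algebraMap F E))),
        ((u : Matrix (Fin (1 + 1)) (Fin (1 + 1)) (AdeleRing (𝓞 E) E)) 0 0 + (u : Matrix (Fin (1 + 1)) (Fin (1 + 1)) (AdeleRing (𝓞 E) E)) 0 1 =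
          (u : Matrix (Fin (1 + 1)) (Fin (1 + 1)) (AdeleRing (𝓞 E) E)) 1 0 + (u : Matrix (Fin (1 + 1)) (Fin (1 + 1)) (AdeleRing (𝓞 E) E)) 1 1) ∧
        adelicMpCont.proj F (Fin (n + n)) (doubledGramFin F (adelicGram F e TV TW)) q = j ⟨u, hu⟩ ∧
        adelicMpCont.l2Scaling F (doubledGramFin F (adelicGram F e TV TW))
            (isUnit_det_doubledGramFin F (adelicGram F e TV TW) (isUnit_det_adelicGram F e hVd hWd)) νX q =
          ((normAbs (v.adicCompletion F) s : ℝ≥0) : ℝ≥0∞) ^ Fintype.card (Fin n) ∧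
        ∀ (Ψ : piSchwartzBruhat F (Fin (n + n))) (x : Fin (n + n) → AdeleRing (𝓞 F) F),
          ((adelicMpCont.omega F (Fin (n + n)) (doubledGramFin F (adelicGram F e TV TW)) q Ψ : piSchwartzBruhat F (Fin (n + n))) :
              (Fin (n + n) → AdeleRing (𝓞 F) F) → ℂ) x =
            (Ψ : (Fin (n + n) → AdeleRing (𝓞 F) F) → ℂ) (fr.symm (((s⁻¹ • (fr x).1.1, (fr x).1.2)), (fr x).2)) := by
  intro s hs0
  -- (ζ) the one-place torus idele with `(V_w, V_w̄) = (s⁻¹, 1)` at `v`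
  have hidl := hIDL s⁻¹ (inv_ne_zero hs0)
  obtain ⟨t, p₂, q₂, a, b, hp₂re, hq₂im, hp₂v, hq₂v, hw, hwbar, hp₂, hq₂, hN, p₂', q₂', h1, h1'⟩ := hidl
  -- (ε) the torus twist `Mt = M(p₂,q₂)` as an element of `GL_{n+n}(𝔸_F)`
  have hε := UnitaryGroup.exists_torusTwistGL (adelicGram F e TV TW) (isUnit_det_adelicGram F e hVd hWd) h1 h1'
  obtain ⟨Mt, hMt, hMt'⟩ := hε
  -- (α) the metaplectic lift over the Levi element `d(t)`
  have hα := E2SWBorelBoundTorus.exists_lift_torus F E c hcδ hδ hd N e TW hV hW2 hVd hWd h2 hTW hTs u₀ hu₀ jS hjS j hj hM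
    t _ _ p₂ q₂ rfl rfl hp₂re hq₂im Mt hMt
  obtain ⟨q, hqproj, hqω⟩ := hα
  refine ⟨q, _, cayley_conj_diag_mem_adelic F E c TW h2 hTW hM t, ?_, hqproj, ?_, fun Ψ x => ?_⟩
  · -- (β) the row-sum condition of `M · diag(t, (c̄t)⁻¹) · M⁻¹`
    have hM0 : (M : Matrix (Fin 2) (Fin 2) (AdeleRing (𝓞 E) E)) 0 0 = 1 := by
      rw [hM]; rfl
    have hM1 : (M : Matrix (Fin 2) (Fin 2) (AdeleRing (𝓞 E) E)) 1 0 = 1 := by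
      rw [hM]; rfl
    have hD10 : ((glDiagonal 2 (AdeleRing (𝓞 E) E)
        ![t, (Units.map (UnitaryGroup.conjAdele F E c : AdeleRing (𝓞 E) E →* AdeleRing (𝓞 E) E) t)⁻¹] : GL (Fin 2) (AdeleRing (𝓞 E) E)) :
          Matrix (Fin 2) (Fin 2) (AdeleRing (𝓞 E) E)) 1 0 = 0 := by
      rw [coe_glDiagonal, Matrix.diagonal_apply_ne _ (by decide)]
    exact rowSum_conj_of_diag M _ hM0 hM1 hD10
  · -- (γ) `L(q) = |det Mt⁻¹|_𝔸` and (η) `|det Mt⁻¹|_𝔸 = |s|_v ^ n`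
    refine (l2Scaling_eq_of_omega_eq_twistLM F νX _ _ q Mt hqω).trans ?_
    rw [E2SWSplitPlaceTorusNormInverse.adelicAbsDet_torusTwist_inv_eq_normAbs_pow_inv F v (adelicGram F e TV TW)
        (isUnit_det_adelicGram F e hVd hWd) Mt hMt' h1 h1' hN (inv_ne_zero hs0), inv_inv, ENNReal.coe_pow, Fintype.card_fin]
  · -- (δ) the frame reads the twist as the dilation of the `x`-half
    have hfr : ∀ x, fr x = (β (evalAt F (Fin (n + n)) v x), ((placeSplitting F (Fin (n + n)) v).symm x).2) := fun x =>
      Prod.ext ((he1 x).trans (hβv _)) (he2 x)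
    have hω := congrArg (fun T : piSchwartzBruhat F (Fin (n + n)) => ((T : piSchwartzBruhat F (Fin (n + n))) :
      (Fin (n + n) → AdeleRing (𝓞 F) F) → ℂ) x) (hqω Ψ)
    exact hω.trans (E2SWSplitPlaceFrame.twistLM_torus_apply F N e TV hV hVd TW hW hWd v hs β hβ fr hfr p₂ q₂ a b hp₂v hq₂v hp₂ hq₂
      Mt hMt hw hwbar Ψ x)

end Letters

end Summit.HodgeConjecture.HodgeConjecture.Cruxes.H413.E2SWDilateBoundCM

end
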